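/-
Origin: expansion seat `planner-pub-hodgecm-mc-theta-3-g9-0`, handover #S6 17:39Z md5 476fa25f7216 (141 l.; NEW additive Model/Junction leaf (J-satK), imports ONLY Model.Junction.LevelSaturation (hence #342 transitively); ns HodgeCM.Model: conj_mem_awayFromCM, conj_mem_satLevelOf (hK : k_f K' k_f⁻¹ ⊆ K ⇒ g · satLevelOf V K' · g⁻¹ ⊆ satLevelOf V K), conj_mem_satLevelRegimeOf; ns HodgeCM.Level: continuous_conj, def Level.infConj Γ b := the PAIR (Γ(Γ.K ⊓ b⁻¹Γ.K b), Γ.K ⊓ comap (conj b) Γ.K) (torsionFree via arithmeticLevel_mono), infConj_K (rfl, simp), infConj_le, conj_mem_K_of_mem_infConj_K; MAIN exists_level_le_forall_conj_mem_satLevelRegimeOf V hV (k : ↥regimeSubgroup) Γ : ∃ Γ' ≤ Γ, ∀ a ∈ satLevelRegimeOf V hV Γ'.K, k * a * k⁻¹ ∈ satLevelRegimeOf V hV Γ.K (ANY k, no rationality). 0 Prop-defs / 0 records / nothing cited; axioms trio.) (`HOME/mc/pub-hodgecm-mc-theta-3-g9/lean/stage/HodgeCM/Model/Junction/LevelSaturationConj.lean`,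 md5 476fa25f, 141 lines);
landed by the gen-13 packager (p-g13) in gate run 37 as `HodgeCM/Model/Junction/LevelSaturationConj.lean` (packager comment re-wording per the RUN-32 precedent (gate audit (5) rejects the proof-placeholder tokens s-o-r-r-y / a-d-m-i-t anywhere in a source, comments included; owner consents STATUS l.12035/l.12037/l.12045, no objection by the cutoff): that one word inside the seat's provenance COMMENT at l.8 of the source re-spelt `proof-hole` (resp. `adm-token`); no Lean code byte touched).
-/
/-
Origin: CONSTRUCTION seat `planner-pub-hodgecm-mc-theta-3-g9-0` (unit pub-hodgecm-mc-theta-3-g9, gen 9 of mc-theta-3: theta supply /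
second-lift lane; (Θ-sat)/(X1)/(W1) RUN-37 pin-packet owner), 2026-08-19 — NEW ADDITIVE LIGHT LEAF
`HodgeCM/Model/Junction/LevelSaturationConj.lean` for the (Θ-sat)/(W1) pin packet, item (E7c) = J-satK (finite-level transport of the pin's
saturation index under conjugation; BINDER-TRIAGE §57/§60, theta-3-g8 HANDOFF §7 (C-KfSat)).  Imports ONLY mc-discharge-1's
`Model/Junction/LevelSaturation` (t36 #3 2469199ca0a4: `satLevelOf`, `satLevelRegimeOf`; light — `AdelicUnitaryModel` + tree twins), hence
the (W1) root `CM/Basic` (#342 66bed69a8c74: `Level V` = the pair `(Γ, K)`, `K`-order, `Level.inf`) transitively.  KERNEL: one `Level`-valued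
construction (`Level.infConj`) + lemmas; 0 records, 0 `def … : Prop`, nothing cited, 0 proof-hole; expected `#print axioms` ⊆ {propext,
Classical.choice, Quot.sound}.
-/
import Summits.HodgeConjecture.HodgeCM.Model.Junction.LevelSaturation

/-!
# The saturation subgroup under conjugation (J-satK)

For `g ∈ U(V)(𝔸_{L⁺})` with finite-adelic component `g_f = (e g).2` and finite levels `K, K'` with `g_f K' g_f⁻¹ ⊆ K`:
`g · satLevelOf V K' · g⁻¹ ⊆ satLevelOf V K` — `awayFromCM` is normal (a kernel) and `M_{K'} = e⁻¹(U(V)(L ⊗ ℝ) × K')`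
conjugates into `M_K` (`conj_mem_satLevelOf`); the same in the regime model (`conj_mem_satLevelRegimeOf`).  For a LEVEL
`Γ : Level V` (the pair `(Γ, K)` of (W1)) and any `b ∈ U(V)(𝔸_{L⁺,f})` the pair
`Γ.infConj b := (U(L⁺) ∩ K″, K″)`, `K″ := Γ.K ∩ b⁻¹ Γ.K b = {a ∈ Γ.K | b a b⁻¹ ∈ Γ.K}`, is a level `≤ Γ` (compact: closed in
the compact `Γ.K`; open: preimage of an open under the continuous conjugation; torsion free: inside `Γ`) with
`b K″ b⁻¹ ⊆ Γ.K`.  Whence the clause consumed by the theta lane: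

* `exists_level_le_forall_conj_mem_satLevelRegimeOf`: **for every `k ∈ G_U(𝔸)` (regime model) and every level `Γ` there is
  a level `Γ' ≤ Γ` with `k · KΓ(Γ') · k⁻¹ ⊆ KΓ(Γ)`**, `KΓ(Γ) := satLevelRegimeOf V hV Γ.K` the pin's saturation index
  (`Model/ThetaSpaceInputPin.thetaSpaceInputIn_KΓ`) — the finite-level hypothesis `hK` of
  `ThetaSpace.map_leftTranslateHom_thetaSpaceSatOf_le` (`Model/ThetaSpaceSatTranslate`) in mc-glue-1's
  `Model/HStabDischarge` under (Θ-sat).  No rationality of `k` is used: the level is allowed to shrink.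
-/

set_option autoImplicit false

noncomputable section

open Literature.NumberTheory.Automorphic Literature.NumberTheory.Automorphic.UnitaryGroup
open NumberField

namespace HodgeCM

namespace Model

variable {L : CMField} {ι₁ : L →+* ℂ} (V : HermSpace3 L ι₁)

/-- **`awayFromCM` is normal** (it is the kernel of `k ↦ (k_∞)_{w(ι₁)}`). -/
theorem conj_mem_awayFromCM {a : ↥(Literature.NumberTheory.Automorphic.adelicUnitaryGroup (L : Type) V.Hm)}
    (ha : a ∈ awayFromCM 3 (L : Type) ι₁ V.Hm)
    (g : ↥(Literature.NumberTheory.Automorphic.adelicUnitaryGroup (L : Type) V.Hm)) :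
    g * a * g⁻¹ ∈ awayFromCM 3 (L : Type) ι₁ V.Hm := by
  unfold awayFromCM awayFrom at ha ⊢
  exact (MonoidHom.normal_ker _).conj_mem a ha g

/-- **Conjugation of the saturation subgroup**: if the finite component `g_f` of `g` conjugates `K'` into `K`, then
`g · satLevelOf V K' · g⁻¹ ⊆ satLevelOf V K`. -/
theorem conj_mem_satLevelOf
    {K K' : Subgroup (finAdelic (↥(maximalRealSubfield L)) L (IsCMField.complexConj L) 3 V.Hm)}
    (g : ↥(Literature.NumberTheory.Automorphic.adelicUnitaryGroup (L : Type) V.Hm))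
    (hK : ∀ b ∈ K', (cmAdelicProdEquiv (L : Type) 3 V.Hm g).2 * b * ((cmAdelicProdEquiv (L : Type) 3 V.Hm g).2)⁻¹ ∈ K)
    {a : ↥(Literature.NumberTheory.Automorphic.adelicUnitaryGroup (L : Type) V.Hm)} (ha : a ∈ satLevelOf V K') :
    g * a * g⁻¹ ∈ satLevelOf V K := by
  rw [mem_satLevelOf_iff] at ha ⊢
  refine ⟨conj_mem_awayFromCM V ha.1 g, ?_⟩
  rw [mem_cmSplitLevel_iff, map_mul, map_mul, map_inv, Prod.snd_mul, Prod.snd_mul, Prod.snd_inv]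
  exact hK _ ((mem_cmSplitLevel_iff (L : Type) 3 V.Hm K' a).1 ha.2)

/-- **Conjugation of the saturation subgroup, regime model**: for `k` in the regime model of `G_U(𝔸)` whose finite
component conjugates `K'` into `K`, `k · satLevelRegimeOf V hV K' · k⁻¹ ⊆ satLevelRegimeOf V hV K`. -/
theorem conj_mem_satLevelRegimeOf (hV : IsAnisotropic L V.Hm)
    {K K' : Subgroup (finAdelic (↥(maximalRealSubfield L)) L (IsCMField.complexConj L) 3 V.Hm)}
    (k : ↥(HodgeCM.Adelic.regimeSubgroup L V.Hm))
    (hK : ∀ b ∈ K',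
      (cmAdelicProdEquiv (L : Type) 3 V.Hm ((HodgeCM.Adelic.regimeEquiv L V.Hm hV).symm k)).2 * b *
          ((cmAdelicProdEquiv (L : Type) 3 V.Hm ((HodgeCM.Adelic.regimeEquiv L V.Hm hV).symm k)).2)⁻¹ ∈ K)
    {a : ↥(HodgeCM.Adelic.regimeSubgroup L V.Hm)} (ha : a ∈ satLevelRegimeOf V hV K') :
    k * a * k⁻¹ ∈ satLevelRegimeOf V hV K := by
  rw [mem_satLevelRegimeOf_iff] at ha ⊢
  rw [map_mul, map_mul, map_inv]
  exact conj_mem_satLevelOf V _ hK ha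

end Model

/-! ### The level `Γ ⊓ b⁻¹ Γ b` -/

namespace Level

variable {L : CMField} {ι₁ : L →+* ℂ} {V : HermSpace3 L ι₁}

/-- Conjugation by `b` on `U(V)(𝔸_{L⁺,f})` as a (continuous) group endomorphism. -/
theorem continuous_conj (b : V.adelicFin) :
    Continuous ((MulAut.conj b).toMonoidHom : V.adelicFin →* V.adelicFin) := by
  show Continuous fun a : V.adelicFin => b * a * b⁻¹
  exact (continuous_const.mul continuous_id).mul continuous_const

/-- **The level `Γ ⊓ b⁻¹ Γ b`**: the pair `(U(L⁺) ∩ K″, K″)` with `K″ := Γ.K ⊓ (conj b)⁻¹ Γ.K = {a ∈ Γ.K | b a b⁻¹ ∈ Γ.K}`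
— compact (closed in the compact `Γ.K`), open (continuous preimage of an open), torsion free (inside `Γ`). -/
def infConj (Γ : Level V) (b : V.adelicFin) : Level V where
  Γ := UnitaryGroup.arithmeticLevel (↥(maximalRealSubfield L)) L (IsCMField.complexConj L) 3 V.Hm
    (Γ.K ⊓ Γ.K.comap (MulAut.conj b).toMonoidHom)
  K := Γ.K ⊓ Γ.K.comap (MulAut.conj b).toMonoidHom
  isCompact_K := Γ.isCompact_K.inter_right ((Γ.K.isClosed_of_isOpen Γ.isOpen_K).preimage (continuous_conj b))
  isOpen_K := Γ.isOpen_K.inter (Γ.isOpen_K.preimage (continuous_conj b))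
  arithmeticLevel_K := rfl
  torsionFree γ hγ hfin := by
    have hmono := UnitaryGroup.arithmeticLevel_mono (F := ↥(maximalRealSubfield L)) (E := L)
      (c := IsCMField.complexConj L) (N := 3) (J := V.Hm)
      (inf_le_left : Γ.K ⊓ Γ.K.comap (MulAut.conj b).toMonoidHom ≤ Γ.K)
    rw [Γ.arithmeticLevel_K] at hmono
    exact Γ.torsionFree γ (hmono hγ) hfin

/-- (Ported verbatim from the HodgeCMPerL package; no docstring in the source.) -/
@[simp] theorem infConj_K (Γ : Level V) (b : V.adelicFin) :
    (Γ.infConj b).K = Γ.K ⊓ Γ.K.comap (MulAut.conj b).toMonoidHom := rfl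

/-- `Γ.infConj b ≤ Γ` (in the `K`-order of record). -/
theorem infConj_le (Γ : Level V) (b : V.adelicFin) : Γ.infConj b ≤ Γ := Level.le_def.mpr inf_le_left

/-- `b (Γ.infConj b).K b⁻¹ ⊆ Γ.K`. -/
theorem conj_mem_K_of_mem_infConj_K (Γ : Level V) (b : V.adelicFin) {a : V.adelicFin} (ha : a ∈ (Γ.infConj b).K) :
    b * a * b⁻¹ ∈ Γ.K :=
  (Subgroup.mem_inf.mp ha).2

end Level

namespace Model

variable {L : CMField} {ι₁ : L →+* ℂ} (V : HermSpace3 L ι₁)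

/-- **J-satK (pin side)**: for every `k` in the regime model of `G_U(𝔸)` and every level `Γ` there is a level `Γ' ≤ Γ`
whose saturation index is conjugated by `k` into that of `Γ`:
`k · satLevelRegimeOf V hV Γ'.K · k⁻¹ ⊆ satLevelRegimeOf V hV Γ.K` (`Γ' := Γ.infConj k_f`). -/
theorem exists_level_le_forall_conj_mem_satLevelRegimeOf (hV : IsAnisotropic L V.Hm)
    (k : ↥(HodgeCM.Adelic.regimeSubgroup L V.Hm)) (Γ : Level V) :
    ∃ Γ' : Level V, Γ' ≤ Γ ∧
      ∀ a ∈ satLevelRegimeOf V hV Γ'.K, k * a * k⁻¹ ∈ satLevelRegimeOf V hV Γ.K :=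
  ⟨Γ.infConj (cmAdelicProdEquiv (L : Type) 3 V.Hm ((HodgeCM.Adelic.regimeEquiv L V.Hm hV).symm k)).2,
    Level.infConj_le _ _,
    fun _ ha => conj_mem_satLevelRegimeOf V hV k (fun _ hb => Level.conj_mem_K_of_mem_infConj_K _ _ hb) ha⟩

end Model

end HodgeCM

end
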